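/-
Copyright (c) 2026 the pub-hodgecm-mathlib formalisation cell (harness21).  Prover seat hodgecm-mathlib-K2E1-p10 (g2), Track B ∕ K2-LIT (build stream 29), h413 = `stmt-HodgeConjecture-24833`,
route of record `HCCMUnconditional`, ROADCARD «5Res ENDGAME BY FAMILIES» §2 C7∕C9 glue; dealer K2E1-plan (g7) — THE WORLD BRIDGE: ★ f1's cuspidal density for `U(Φ₂)` (literal form
`Φ₂`, `cmParabolicData`) transported to Mok's `quasiSplit L⁺ L c 2` (form `(antidiagonal 2).over L`), the world of `eisensteinSeriesU` ∕ `borelHeight` ∕ `chiSectionSpace` ∕ the C7 HEAD.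
-/
import Summits.HodgeConjecture.HodgeConjecture.Theorems.K2E1PseudoEisensteinDensityU        -- ★ f1-CM (K2E1-p09): `cmCuspidalSubspace_orthogonal_eq_topologicalClosure_span_two`
import Summits.HodgeConjecture.HodgeConjecture.Theorems.K2E1SiegelRadicalCocompactU2       -- ★ `upperUnitriangular_eq_standardUnipotentRadical_two`, transitively `cmParabolicData`, ★ `antidiagOne_eq_over`
import Literature.NumberTheory.Automorphic.UnitaryGroupGenericity                         -- ★ `mem_adelicUnipotent_iff`
import HarnessLib

/-!
# h413 ∕ Track B «K2-LIT», ROADCARD «5Res BY FAMILIES» C7∕C9 GLUE — helper `K2E1CuspidalDensityQuasiSplitBridgeCMTwo`: **in the `quasiSplit L⁺ L c 2` world there is Borel parabolic data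
# `𝔓` (all radicals `= adelicUnipotent`) whose cuspidal subspace satisfies ★ f1's density `(L²_cusp)ᗮ = closure span {[θ_Φ] : Φ ∈ 𝒯_i}`** — the `(𝔓, h𝔓, W, hE)` of the C7 HEAD
# ★ `K2E1PseudoEisensteinFamilyDecompositionU2.orthogonal_inf_invariants_le_topologicalClosure_iSup_family`, discharged

Cell `pub/hodgecm-mathlib`, crux h413 = `stmt-HodgeConjecture-24833`, route of record `HCCMUnconditional`; dealer K2E1-plan (g7).  THEOREMS ONLY (no `def`, no `instance`, no notation, no
named-fact hypothesis, no `sorry`); lane `--supports stmt-HodgeConjecture-24833 --as helper` (count-neutral).  Closes no socket.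

THE TWO WORLDS.  ★ f1 ∕ T9′ speak of `cmDatum L 2 Φ₂` with the literal antidiagonal-one matrix `Φ₂ = Matrix.of …` and the parabolic datum ★ `cmParabolicData L 2` (radical
`val⁻¹(1 + 𝔫_1)`); the Bernstein–Lapid ∕ (χ,τ) files and the C7 HEAD speak of Mok's `quasiSplit L⁺ L c 2 = adelicGroupData L⁺ L c 2 ((StdForm.antidiagonal 2).over L)` (`rfl`).  The two
matrices are EQUAL (★ `antidiagOne_eq_over`) but not definitionally, so we transport by the tree's two-step device (★ `K2E1BorelLeviUDomains` §2): state the density for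
`adelicGroupData L⁺ L c 2 J` with `J` ANY matrix equal to `Φ₂` and an EXISTENTIAL parabolic datum whose radicals are the inline comap `val_J⁻¹(1 + 𝔫_1)`, prove it at `J = Φ₂` by `subst`
from ★ f1-CM with the witness `cmParabolicData L 2`, then read it at `J = (StdForm.antidiagonal 2).over L`, where `val⁻¹(1 + 𝔫_1) = val⁻¹(upper unitriangular) = adelicUnipotent`
(★ `upperUnitriangular_eq_standardUnipotentRadical_two`, ★ `mem_adelicUnipotent_iff`).

* §1 `exists_parabolicData_orthogonal_eq_of_eq` (`J`-generic by `subst`).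
* §2 **`exists_parabolicData_orthogonal_eq_quasiSplit_two`**: `∃ 𝔓 : (quasiSplit L⁺ L c 2).ParabolicUnipotentData, (∀ i, 𝔓.radical i = adelicUnipotent L⁺ L c 2) ∧
  ∀ μ automorphic, ((quasiSplit …).cuspidalSubspace μ 𝔓).toSubmoduleᗮ = (span ℂ Θ(𝔓, μ)).topologicalClosure` (Θ in ★ f1's `hθ`-witness shape = the C7 HEAD's `hΘ`).

HONEST LABEL: HC_CM is proved only modulo the 7 printed citations (2 remaining named inputs: hLiu418 = `stmt-HodgeConjecture-24832`, h413 = `stmt-HodgeConjecture-24833`) until rung 0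
closes; this file asserts no named fact and closes no socket.
References: [MoeglinWaldspurger1995] C. Mœglin, J.-L. Waldspurger, *Spectral Decomposition and Eisenstein Series*, II.1.2–II.1.4; [BorelJacquet1979] A. Borel, H. Jacquet, *Automorphic
forms and automorphic representations*, §4.4, §4.6; [Garrett2018] P. Garrett, *Modern Analysis of Automorphic Forms by Example*, §1.8.
-/

set_option autoImplicit false
set_option linter.dupNamespace false  -- the mandated namespace repeats the summit's segment (`HodgeConjecture.HodgeConjecture`)

noncomputable section

open MeasureTheory Measure Set Filter Topology NumberField
open Literature.NumberTheory.Automorphic Literature.NumberTheory.Automorphic.UnitaryGroup AdelicGroupData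
open Summit.HodgeConjecture.HodgeConjecture.Cruxes.H413.K2E1CuspidalSpectrumUnitary (cmUnipotentRadical cmParabolicData cmCuspidalSubspace cmParabolicData_radical)
open Summit.HodgeConjecture.HodgeConjecture.Cruxes.H413.K2E1SiegelRadicalCocompactU2 (upperUnitriangular_eq_standardUnipotentRadical_two)
open Summit.HodgeConjecture.HodgeConjecture.Cruxes.H413.K2E1PseudoEisensteinDensityU (cmCuspidalSubspace_orthogonal_eq_topologicalClosure_span_two)
open scoped ENNReal NNReal

namespace Summit.HodgeConjecture.HodgeConjecture.Cruxes.H413.K2E1CuspidalDensityQuasiSplitBridgeCMTwo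

variable (L : Type) [Field L] [NumberField L] [IsCMField L]

/-! ## §1 `J`-generic by substitution -/

/-- **★ f1's DENSITY, `J`-GENERIC**: for `J` ANY matrix equal to the literal `Φ₂`, the datum `adelicGroupData L⁺ L c 2 J` carries parabolic data with every radical the inline Siegel
radical `val_J⁻¹(1 + 𝔫_1)` and satisfying `(L²_cusp)ᗮ = closure span {[θ_Φ] : Φ ∈ 𝒯_i}` for every automorphic `μ` (at `J = Φ₂`: ★ `cmParabolicData L 2` and ★
`cmCuspidalSubspace_orthogonal_eq_topologicalClosure_span_two`, by `subst`). [cite: MoeglinWaldspurger1995, II.1.2–II.1.4] [cite: BorelJacquet1979, §4.6] -/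
theorem exists_parabolicData_orthogonal_eq_of_eq {J : Matrix (Fin 2) (Fin 2) L} (hJ : (Matrix.of fun i j : Fin 2 => if i.val + j.val + 1 = 2 then (1 : L) else 0) = J) :
    ∃ 𝔓 : (adelicGroupData (↥(maximalRealSubfield L)) L (IsCMField.complexConj L) 2 J).ParabolicUnipotentData,
      (∀ i : 𝔓.ι, 𝔓.radical i = (standardUnipotentRadical 2 1 (AdeleRing (𝓞 L) L)).comap (adelicVal (↥(maximalRealSubfield L)) L (IsCMField.complexConj L) 2 J)) ∧
      ∀ {mG : MeasurableSpace (adelicGroupData (↥(maximalRealSubfield L)) L (IsCMField.complexConj L) 2 J).Adelic}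
        (_ : BorelSpace (adelicGroupData (↥(maximalRealSubfield L)) L (IsCMField.complexConj L) 2 J).Adelic)
        (μ : Measure (adelicGroupData (↥(maximalRealSubfield L)) L (IsCMField.complexConj L) 2 J).automorphicQuotient)
        (_ : (adelicGroupData (↥(maximalRealSubfield L)) L (IsCMField.complexConj L) 2 J).IsAutomorphicMeasure μ),
        ((adelicGroupData (↥(maximalRealSubfield L)) L (IsCMField.complexConj L) 2 J).cuspidalSubspace μ 𝔓).toSubmoduleᗮ =
          (Submodule.span ℂ {f : (adelicGroupData (↥(maximalRealSubfield L)) L (IsCMField.complexConj L) 2 J).L2 μ |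
            ∃ (i : 𝔓.ι) (Φ : (adelicGroupData (↥(maximalRealSubfield L)) L (IsCMField.complexConj L) 2 J).Adelic → ℂ) (_ : Measurable Φ)
              (_ : ∀ (g : (adelicGroupData (↥(maximalRealSubfield L)) L (IsCMField.complexConj L) 2 J).Adelic) (n : 𝔓.radical i), Φ (g * n) = Φ g)
              (_ : ∫⁻ x, (∑' q : (adelicGroupData (↥(maximalRealSubfield L)) L (IsCMField.complexConj L) 2 J).quotientSubgroup ⧸
                  (𝔓.radical i).subgroupOf (adelicGroupData (↥(maximalRealSubfield L)) L (IsCMField.complexConj L) 2 J).quotientSubgroup,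
                    ‖Φ ((Quotient.out x : (adelicGroupData (↥(maximalRealSubfield L)) L (IsCMField.complexConj L) 2 J).Adelic) *
                      (q.out : (adelicGroupData (↥(maximalRealSubfield L)) L (IsCMField.complexConj L) 2 J).Adelic))‖ₑ) ^ 2 ∂μ < ∞)
              (hθ : MemLp (fun x : (adelicGroupData (↥(maximalRealSubfield L)) L (IsCMField.complexConj L) 2 J).automorphicQuotient =>
                  ∑' q : (adelicGroupData (↥(maximalRealSubfield L)) L (IsCMField.complexConj L) 2 J).quotientSubgroup ⧸
                    (𝔓.radical i).subgroupOf (adelicGroupData (↥(maximalRealSubfield L)) L (IsCMField.complexConj L) 2 J).quotientSubgroup,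
                      Φ ((Quotient.out x : (adelicGroupData (↥(maximalRealSubfield L)) L (IsCMField.complexConj L) 2 J).Adelic) *
                        (q.out : (adelicGroupData (↥(maximalRealSubfield L)) L (IsCMField.complexConj L) 2 J).Adelic))) 2 μ),
              f = hθ.toLp _}).topologicalClosure := by
  subst hJ
  refine ⟨cmParabolicData L 2, fun i => ?_, @fun mG hB μ hμ => ?_⟩
  · obtain ⟨k, hk⟩ := i
    obtain rfl : k = 1 := by omega
    rfl
  · letI : MeasurableSpace (cmDatum L 2 (Matrix.of fun i j : Fin 2 => if i.val + j.val + 1 = 2 then (1 : L) else 0)).Adelic := mG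
    haveI : BorelSpace (cmDatum L 2 (Matrix.of fun i j : Fin 2 => if i.val + j.val + 1 = 2 then (1 : L) else 0)).Adelic := hB
    haveI : (cmDatum L 2 (Matrix.of fun i j : Fin 2 => if i.val + j.val + 1 = 2 then (1 : L) else 0)).IsAutomorphicMeasure μ := hμ
    exact cmCuspidalSubspace_orthogonal_eq_topologicalClosure_span_two L μ

/-! ## §2 The `quasiSplit` print -/

/-- `val⁻¹(1 + 𝔫_1) = N(𝔸)` for `U(J₂)`: the Siegel radical of the split form read through ★ `upperUnitriangular_eq_standardUnipotentRadical_two` is ★ `adelicUnipotent`. [cite: Rogawski1990, §1.10] -/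
theorem comap_standardUnipotentRadical_eq_adelicUnipotent :
    (standardUnipotentRadical 2 1 (AdeleRing (𝓞 L) L)).comap (adelicVal (↥(maximalRealSubfield L)) L (IsCMField.complexConj L) 2 ((StdForm.antidiagonal 2).over L)) =
      adelicUnipotent (↥(maximalRealSubfield L)) L (IsCMField.complexConj L) 2 := by
  ext g
  rw [Subgroup.mem_comap, mem_adelicUnipotent_iff, upperUnitriangular_eq_standardUnipotentRadical_two]

/-- **THE BRIDGE — ★ f1's CUSPIDAL DENSITY IN THE `quasiSplit L⁺ L c 2` WORLD**: there is parabolic data `𝔓` for Mok's `U(J₂)` with EVERY radical `= adelicUnipotent L⁺ L c 2` such that,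
for every automorphic `μ`, `((quasiSplit …).cuspidalSubspace μ 𝔓)ᗮ = closure span {[θ_Φ] : i, Φ ∈ 𝒯_i}` in ★ f1's `hθ`-witness shape — exactly the `(𝔓, h𝔓, W := cuspidal, hΘ := rfl, hE)`
of the C7 HEAD ★ `orthogonal_inf_invariants_le_topologicalClosure_iSup_family`. [cite: MoeglinWaldspurger1995, II.1.2–II.1.4] [cite: BorelJacquet1979, §4.6] -/
theorem exists_parabolicData_orthogonal_eq_quasiSplit_two :
    ∃ 𝔓 : (quasiSplit (↥(maximalRealSubfield L)) L (IsCMField.complexConj L) 2).ParabolicUnipotentData,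
      (∀ i : 𝔓.ι, 𝔓.radical i = adelicUnipotent (↥(maximalRealSubfield L)) L (IsCMField.complexConj L) 2) ∧
      ∀ {mG : MeasurableSpace (quasiSplit (↥(maximalRealSubfield L)) L (IsCMField.complexConj L) 2).Adelic}
        (_ : BorelSpace (quasiSplit (↥(maximalRealSubfield L)) L (IsCMField.complexConj L) 2).Adelic)
        (μ : Measure (quasiSplit (↥(maximalRealSubfield L)) L (IsCMField.complexConj L) 2).automorphicQuotient)
        (_ : (quasiSplit (↥(maximalRealSubfield L)) L (IsCMField.complexConj L) 2).IsAutomorphicMeasure μ),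
        ((quasiSplit (↥(maximalRealSubfield L)) L (IsCMField.complexConj L) 2).cuspidalSubspace μ 𝔓).toSubmoduleᗮ =
          (Submodule.span ℂ {f : (quasiSplit (↥(maximalRealSubfield L)) L (IsCMField.complexConj L) 2).L2 μ |
            ∃ (i : 𝔓.ι) (Φ : (quasiSplit (↥(maximalRealSubfield L)) L (IsCMField.complexConj L) 2).Adelic → ℂ) (_ : Measurable Φ)
              (_ : ∀ (g : (quasiSplit (↥(maximalRealSubfield L)) L (IsCMField.complexConj L) 2).Adelic) (n : 𝔓.radical i), Φ (g * n) = Φ g)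
              (_ : ∫⁻ x, (∑' q : (quasiSplit (↥(maximalRealSubfield L)) L (IsCMField.complexConj L) 2).quotientSubgroup ⧸
                  (𝔓.radical i).subgroupOf (quasiSplit (↥(maximalRealSubfield L)) L (IsCMField.complexConj L) 2).quotientSubgroup,
                    ‖Φ ((Quotient.out x : (quasiSplit (↥(maximalRealSubfield L)) L (IsCMField.complexConj L) 2).Adelic) *
                      (q.out : (quasiSplit (↥(maximalRealSubfield L)) L (IsCMField.complexConj L) 2).Adelic))‖ₑ) ^ 2 ∂μ < ∞)
              (hθ : MemLp (fun x : (quasiSplit (↥(maximalRealSubfield L)) L (IsCMField.complexConj L) 2).automorphicQuotient =>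
                  ∑' q : (quasiSplit (↥(maximalRealSubfield L)) L (IsCMField.complexConj L) 2).quotientSubgroup ⧸
                    (𝔓.radical i).subgroupOf (quasiSplit (↥(maximalRealSubfield L)) L (IsCMField.complexConj L) 2).quotientSubgroup,
                      Φ ((Quotient.out x : (quasiSplit (↥(maximalRealSubfield L)) L (IsCMField.complexConj L) 2).Adelic) *
                        (q.out : (quasiSplit (↥(maximalRealSubfield L)) L (IsCMField.complexConj L) 2).Adelic))) 2 μ),
              f = hθ.toLp _}).topologicalClosure := by
  obtain ⟨𝔓, h𝔓, hE⟩ := exists_parabolicData_orthogonal_eq_of_eq L (antidiagOne_eq_over (L := L) (N := 2))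
  refine ⟨𝔓, fun i => (h𝔓 i).trans (comap_standardUnipotentRadical_eq_adelicUnipotent L), fun hB μ hμ => hE hB μ hμ⟩

/-! ## §3 (ED.2, boxer T129 F1 «junk-∃ export») The cusp space and the generating set depend only on the SET of radicals; the ∀-GUARDED density -/

section Generic

variable {K : Type} [Field K] [NumberField K] {𝒢 : AdelicGroupData K}

/-- **The constant-term condition depends on the index only through the radical**: if `𝔓.radical i = 𝔓'.radical j` then `ConstantTermVanishes 𝔓 φ i ↔ ConstantTermVanishes 𝔓' φ j`
(`subst` on a Subgroup variable). [cite: BorelJacquet1979, §4.4] -/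
theorem constantTermVanishes_iff_of_radical_eq (𝔓 𝔓' : 𝒢.ParabolicUnipotentData) {i : 𝔓.ι} {j : 𝔓'.ι} (h : 𝔓.radical i = 𝔓'.radical j)
    (φ : 𝒢.automorphicQuotient → ℂ) : 𝒢.ConstantTermVanishes 𝔓 φ i ↔ 𝒢.ConstantTermVanishes 𝔓' φ j := by
  have key : ∀ (𝔔 : 𝒢.ParabolicUnipotentData) (k : 𝔔.ι) (R : Subgroup 𝒢.Adelic), 𝔔.radical k = R →
      (𝒢.ConstantTermVanishes 𝔔 φ k ↔ ∀ [MeasurableSpace R] [BorelSpace R] (ν : Measure R) [ν.IsHaarMeasure] (𝓕 : Set R),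
        IsFundamentalDomain (𝒢.arithmeticSubgroup.comap R.subtype) 𝓕 ν →
          ∀ x : 𝒢.Adelic, IntegrableOn (fun u : R => φ (𝒢.toAutomorphicQuotient (x * (u : 𝒢.Adelic)⁻¹))) 𝓕 ν ∧
            ∫ u in 𝓕, φ (𝒢.toAutomorphicQuotient (x * (u : 𝒢.Adelic)⁻¹)) ∂ν = 0) := by
    intro 𝔔 k R hR; subst hR; exact Iff.rfl
  exact (key 𝔓 i _ h).trans (key 𝔓' j _ rfl).symm

/-- **Cusp forms depend only on the set of radicals**: two parabolic data with non-empty indices and the same radicals everywhere have the same `cuspForms`. [cite: BorelJacquet1979, §4.4] -/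
theorem cuspForms_eq_of_forall_radical_eq (μ : Measure 𝒢.automorphicQuotient) (𝔓 𝔓' : 𝒢.ParabolicUnipotentData) [Nonempty 𝔓.ι] [Nonempty 𝔓'.ι]
    (h : ∀ (i : 𝔓.ι) (j : 𝔓'.ι), 𝔓.radical i = 𝔓'.radical j) : 𝒢.cuspForms μ 𝔓 = 𝒢.cuspForms μ 𝔓' := by
  ext φ
  change (Continuous φ ∧ MemLp φ 2 μ ∧ ∀ i, 𝒢.ConstantTermVanishes 𝔓 φ i) ↔ (Continuous φ ∧ MemLp φ 2 μ ∧ ∀ j, 𝒢.ConstantTermVanishes 𝔓' φ j)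
  refine ⟨fun ⟨hc, hm, hct⟩ => ⟨hc, hm, fun j => ?_⟩, fun ⟨hc, hm, hct⟩ => ⟨hc, hm, fun i => ?_⟩⟩
  · obtain ⟨i⟩ := (inferInstance : Nonempty 𝔓.ι)
    exact (constantTermVanishes_iff_of_radical_eq 𝔓 𝔓' (h i j) φ).1 (hct i)
  · obtain ⟨j⟩ := (inferInstance : Nonempty 𝔓'.ι)
    exact (constantTermVanishes_iff_of_radical_eq 𝔓 𝔓' (h i j) φ).2 (hct j)

/-- **The cuspidal subspace depends only on the set of radicals** (as a submodule of `L²`). [cite: BorelJacquet1979, §4.4–4.6] -/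
theorem toSubmodule_cuspidalSubspace_eq_of_forall_radical_eq [MeasurableSpace 𝒢.Adelic] [BorelSpace 𝒢.Adelic] (μ : Measure 𝒢.automorphicQuotient) [𝒢.IsAutomorphicMeasure μ]
    (𝔓 𝔓' : 𝒢.ParabolicUnipotentData) [Nonempty 𝔓.ι] [Nonempty 𝔓'.ι] (h : ∀ (i : 𝔓.ι) (j : 𝔓'.ι), 𝔓.radical i = 𝔓'.radical j) :
    (𝒢.cuspidalSubspace μ 𝔓).toSubmodule = (𝒢.cuspidalSubspace μ 𝔓').toSubmodule := by
  have hcf := cuspForms_eq_of_forall_radical_eq μ 𝔓 𝔓' h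
  have hrange : LinearMap.range (𝒢.cuspFormsToLp μ 𝔓) = LinearMap.range (𝒢.cuspFormsToLp μ 𝔓') := by
    ext v
    simp only [LinearMap.mem_range]
    constructor
    · rintro ⟨φ, rfl⟩
      exact ⟨⟨φ.1, by rw [← hcf]; exact φ.2⟩, rfl⟩
    · rintro ⟨φ, rfl⟩
      exact ⟨⟨φ.1, by rw [hcf]; exact φ.2⟩, rfl⟩
  change (LinearMap.range (𝒢.cuspFormsToLp μ 𝔓)).topologicalClosure = (LinearMap.range (𝒢.cuspFormsToLp μ 𝔓')).topologicalClosure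
  rw [hrange]

/-- **The generating set `Θ(𝔓) = {[θ_Φ] : i, Φ ∈ 𝒯_i}` depends only on the set of radicals** (★ f1's `hθ`-witness shape). [cite: MoeglinWaldspurger1995, II.1.2] -/
theorem setOf_pseudoEisenstein_eq_of_forall_radical_eq [MeasurableSpace 𝒢.Adelic] (μ : Measure 𝒢.automorphicQuotient)
    (𝔓 𝔓' : 𝒢.ParabolicUnipotentData) [Nonempty 𝔓.ι] [Nonempty 𝔓'.ι] (h : ∀ (i : 𝔓.ι) (j : 𝔓'.ι), 𝔓.radical i = 𝔓'.radical j) :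
    {f : 𝒢.L2 μ | ∃ (i : 𝔓.ι) (Φ : 𝒢.Adelic → ℂ) (_ : Measurable Φ) (_ : ∀ (g : 𝒢.Adelic) (n : 𝔓.radical i), Φ (g * n) = Φ g)
        (_ : ∫⁻ x, (∑' q : 𝒢.quotientSubgroup ⧸ (𝔓.radical i).subgroupOf 𝒢.quotientSubgroup, ‖Φ ((Quotient.out x : 𝒢.Adelic) * ((q.out : 𝒢.quotientSubgroup) : 𝒢.Adelic))‖ₑ) ^ 2 ∂μ < ∞)
        (hθ : MemLp (fun x : 𝒢.automorphicQuotient => ∑' q : 𝒢.quotientSubgroup ⧸ (𝔓.radical i).subgroupOf 𝒢.quotientSubgroup,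
          Φ ((Quotient.out x : 𝒢.Adelic) * ((q.out : 𝒢.quotientSubgroup) : 𝒢.Adelic))) 2 μ), f = hθ.toLp _} =
    {f : 𝒢.L2 μ | ∃ (j : 𝔓'.ι) (Φ : 𝒢.Adelic → ℂ) (_ : Measurable Φ) (_ : ∀ (g : 𝒢.Adelic) (n : 𝔓'.radical j), Φ (g * n) = Φ g)
        (_ : ∫⁻ x, (∑' q : 𝒢.quotientSubgroup ⧸ (𝔓'.radical j).subgroupOf 𝒢.quotientSubgroup, ‖Φ ((Quotient.out x : 𝒢.Adelic) * ((q.out : 𝒢.quotientSubgroup) : 𝒢.Adelic))‖ₑ) ^ 2 ∂μ < ∞)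
        (hθ : MemLp (fun x : 𝒢.automorphicQuotient => ∑' q : 𝒢.quotientSubgroup ⧸ (𝔓'.radical j).subgroupOf 𝒢.quotientSubgroup,
          Φ ((Quotient.out x : 𝒢.Adelic) * ((q.out : 𝒢.quotientSubgroup) : 𝒢.Adelic))) 2 μ), f = hθ.toLp _} := by
  -- the membership predicate as a function of the radical alone
  have key : ∀ (R R' : Subgroup 𝒢.Adelic), R = R' → ∀ f : 𝒢.L2 μ,
      (∃ (Φ : 𝒢.Adelic → ℂ) (_ : Measurable Φ) (_ : ∀ (g : 𝒢.Adelic) (n : R), Φ (g * n) = Φ g)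
        (_ : ∫⁻ x, (∑' q : 𝒢.quotientSubgroup ⧸ R.subgroupOf 𝒢.quotientSubgroup, ‖Φ ((Quotient.out x : 𝒢.Adelic) * ((q.out : 𝒢.quotientSubgroup) : 𝒢.Adelic))‖ₑ) ^ 2 ∂μ < ∞)
        (hθ : MemLp (fun x : 𝒢.automorphicQuotient => ∑' q : 𝒢.quotientSubgroup ⧸ R.subgroupOf 𝒢.quotientSubgroup,
          Φ ((Quotient.out x : 𝒢.Adelic) * ((q.out : 𝒢.quotientSubgroup) : 𝒢.Adelic))) 2 μ), f = hθ.toLp _) ↔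
      (∃ (Φ : 𝒢.Adelic → ℂ) (_ : Measurable Φ) (_ : ∀ (g : 𝒢.Adelic) (n : R'), Φ (g * n) = Φ g)
        (_ : ∫⁻ x, (∑' q : 𝒢.quotientSubgroup ⧸ R'.subgroupOf 𝒢.quotientSubgroup, ‖Φ ((Quotient.out x : 𝒢.Adelic) * ((q.out : 𝒢.quotientSubgroup) : 𝒢.Adelic))‖ₑ) ^ 2 ∂μ < ∞)
        (hθ : MemLp (fun x : 𝒢.automorphicQuotient => ∑' q : 𝒢.quotientSubgroup ⧸ R'.subgroupOf 𝒢.quotientSubgroup,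
          Φ ((Quotient.out x : 𝒢.Adelic) * ((q.out : 𝒢.quotientSubgroup) : 𝒢.Adelic))) 2 μ), f = hθ.toLp _) := by
    intro R R' hRR' f; subst hRR'; exact Iff.rfl
  obtain ⟨i₀⟩ := (inferInstance : Nonempty 𝔓.ι)
  obtain ⟨j₀⟩ := (inferInstance : Nonempty 𝔓'.ι)
  ext f
  constructor
  · rintro ⟨i, hrest⟩
    exact ⟨j₀, (key _ _ (h i j₀) f).1 hrest⟩
  · rintro ⟨j, hrest⟩
    exact ⟨i₀, (key _ _ (h i₀ j) f).2 hrest⟩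

end Generic

/-- §1′ (ED.2): ★ §1 WITH THE NON-EMPTINESS OF THE INDEX EXPORTED (the witness is ★ `cmParabolicData L 2`, index `{k // 1 ≤ k ∧ 2k ≤ 2} = {1}`). [cite: MoeglinWaldspurger1995, II.1.2–II.1.4] -/
theorem exists_parabolicData_orthogonal_eq_of_eq' {J : Matrix (Fin 2) (Fin 2) L} (hJ : (Matrix.of fun i j : Fin 2 => if i.val + j.val + 1 = 2 then (1 : L) else 0) = J) :
    ∃ 𝔓 : (adelicGroupData (↥(maximalRealSubfield L)) L (IsCMField.complexConj L) 2 J).ParabolicUnipotentData, Nonempty 𝔓.ι ∧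
      (∀ i : 𝔓.ι, 𝔓.radical i = (standardUnipotentRadical 2 1 (AdeleRing (𝓞 L) L)).comap (adelicVal (↥(maximalRealSubfield L)) L (IsCMField.complexConj L) 2 J)) ∧
      ∀ {mG : MeasurableSpace (adelicGroupData (↥(maximalRealSubfield L)) L (IsCMField.complexConj L) 2 J).Adelic}
        (_ : BorelSpace (adelicGroupData (↥(maximalRealSubfield L)) L (IsCMField.complexConj L) 2 J).Adelic)
        (μ : Measure (adelicGroupData (↥(maximalRealSubfield L)) L (IsCMField.complexConj L) 2 J).automorphicQuotient)
        (_ : (adelicGroupData (↥(maximalRealSubfield L)) L (IsCMField.complexConj L) 2 J).IsAutomorphicMeasure μ),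
        ((adelicGroupData (↥(maximalRealSubfield L)) L (IsCMField.complexConj L) 2 J).cuspidalSubspace μ 𝔓).toSubmoduleᗮ =
          (Submodule.span ℂ {f : (adelicGroupData (↥(maximalRealSubfield L)) L (IsCMField.complexConj L) 2 J).L2 μ |
            ∃ (i : 𝔓.ι) (Φ : (adelicGroupData (↥(maximalRealSubfield L)) L (IsCMField.complexConj L) 2 J).Adelic → ℂ) (_ : Measurable Φ)
              (_ : ∀ (g : (adelicGroupData (↥(maximalRealSubfield L)) L (IsCMField.complexConj L) 2 J).Adelic) (n : 𝔓.radical i), Φ (g * n) = Φ g)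
              (_ : ∫⁻ x, (∑' q : (adelicGroupData (↥(maximalRealSubfield L)) L (IsCMField.complexConj L) 2 J).quotientSubgroup ⧸
                  (𝔓.radical i).subgroupOf (adelicGroupData (↥(maximalRealSubfield L)) L (IsCMField.complexConj L) 2 J).quotientSubgroup,
                    ‖Φ ((Quotient.out x : (adelicGroupData (↥(maximalRealSubfield L)) L (IsCMField.complexConj L) 2 J).Adelic) *
                      (q.out : (adelicGroupData (↥(maximalRealSubfield L)) L (IsCMField.complexConj L) 2 J).Adelic))‖ₑ) ^ 2 ∂μ < ∞)
              (hθ : MemLp (fun x : (adelicGroupData (↥(maximalRealSubfield L)) L (IsCMField.complexConj L) 2 J).automorphicQuotient =>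
                  ∑' q : (adelicGroupData (↥(maximalRealSubfield L)) L (IsCMField.complexConj L) 2 J).quotientSubgroup ⧸
                    (𝔓.radical i).subgroupOf (adelicGroupData (↥(maximalRealSubfield L)) L (IsCMField.complexConj L) 2 J).quotientSubgroup,
                      Φ ((Quotient.out x : (adelicGroupData (↥(maximalRealSubfield L)) L (IsCMField.complexConj L) 2 J).Adelic) *
                        (q.out : (adelicGroupData (↥(maximalRealSubfield L)) L (IsCMField.complexConj L) 2 J).Adelic))) 2 μ),
              f = hθ.toLp _}).topologicalClosure := by
  subst hJ
  refine ⟨cmParabolicData L 2, ⟨⟨1, le_refl _, le_refl _⟩⟩, fun i => ?_, @fun mG hB μ hμ => ?_⟩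
  · obtain ⟨k, hk⟩ := i
    obtain rfl : k = 1 := by omega
    rfl
  · letI : MeasurableSpace (cmDatum L 2 (Matrix.of fun i j : Fin 2 => if i.val + j.val + 1 = 2 then (1 : L) else 0)).Adelic := mG
    haveI : BorelSpace (cmDatum L 2 (Matrix.of fun i j : Fin 2 => if i.val + j.val + 1 = 2 then (1 : L) else 0)).Adelic := hB
    haveI : (cmDatum L 2 (Matrix.of fun i j : Fin 2 => if i.val + j.val + 1 = 2 then (1 : L) else 0)).IsAutomorphicMeasure μ := hμ
    exact cmCuspidalSubspace_orthogonal_eq_topologicalClosure_span_two L μ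

/-- **THE ∀-GUARDED BRIDGE (ED.2): ★ f1's CUSPIDAL DENSITY FOR EVERY BOREL PARABOLIC DATUM OF `quasiSplit L⁺ L c 2`** — for EVERY `𝔓` with non-empty index and all radicals
`= adelicUnipotent L⁺ L c 2` (in particular the transport of the NAMED ★ `cmParabolicData L 2`; NOT satisfiable by the junk datum `⟨PEmpty, nofun⟩`):
`((quasiSplit …).cuspidalSubspace μ 𝔓)ᗮ = closure span Θ(𝔓)` (§1′ + §3: both sides depend only on the set of radicals). [cite: MoeglinWaldspurger1995, II.1.2–II.1.4] [cite: BorelJacquet1979, §4.6] -/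
theorem orthogonal_eq_topologicalClosure_span_of_borel (𝔓 : (quasiSplit (↥(maximalRealSubfield L)) L (IsCMField.complexConj L) 2).ParabolicUnipotentData) (hne : Nonempty 𝔓.ι)
    (h𝔓 : ∀ i : 𝔓.ι, 𝔓.radical i = adelicUnipotent (↥(maximalRealSubfield L)) L (IsCMField.complexConj L) 2)
    [MeasurableSpace (quasiSplit (↥(maximalRealSubfield L)) L (IsCMField.complexConj L) 2).Adelic] [BorelSpace (quasiSplit (↥(maximalRealSubfield L)) L (IsCMField.complexConj L) 2).Adelic] (μ : Measure (quasiSplit (↥(maximalRealSubfield L)) L (IsCMField.complexConj L) 2).automorphicQuotient) [(quasiSplit (↥(maximalRealSubfield L)) L (IsCMField.complexConj L) 2).IsAutomorphicMeasure μ] :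
    ((quasiSplit (↥(maximalRealSubfield L)) L (IsCMField.complexConj L) 2).cuspidalSubspace μ 𝔓).toSubmoduleᗮ =
      (Submodule.span ℂ {f : (quasiSplit (↥(maximalRealSubfield L)) L (IsCMField.complexConj L) 2).L2 μ |
        ∃ (i : 𝔓.ι) (Φ : (quasiSplit (↥(maximalRealSubfield L)) L (IsCMField.complexConj L) 2).Adelic → ℂ) (_ : Measurable Φ)
          (_ : ∀ (g : (quasiSplit (↥(maximalRealSubfield L)) L (IsCMField.complexConj L) 2).Adelic) (n : 𝔓.radical i), Φ (g * n) = Φ g)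
          (_ : ∫⁻ x, (∑' q : (quasiSplit (↥(maximalRealSubfield L)) L (IsCMField.complexConj L) 2).quotientSubgroup ⧸ (𝔓.radical i).subgroupOf (quasiSplit (↥(maximalRealSubfield L)) L (IsCMField.complexConj L) 2).quotientSubgroup,
              ‖Φ ((Quotient.out x : (quasiSplit (↥(maximalRealSubfield L)) L (IsCMField.complexConj L) 2).Adelic) * ((q.out : (quasiSplit (↥(maximalRealSubfield L)) L (IsCMField.complexConj L) 2).quotientSubgroup) : (quasiSplit (↥(maximalRealSubfield L)) L (IsCMField.complexConj L) 2).Adelic))‖ₑ) ^ 2 ∂μ < ∞)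
          (hθ : MemLp (fun x : (quasiSplit (↥(maximalRealSubfield L)) L (IsCMField.complexConj L) 2).automorphicQuotient => ∑' q : (quasiSplit (↥(maximalRealSubfield L)) L (IsCMField.complexConj L) 2).quotientSubgroup ⧸ (𝔓.radical i).subgroupOf (quasiSplit (↥(maximalRealSubfield L)) L (IsCMField.complexConj L) 2).quotientSubgroup,
              Φ ((Quotient.out x : (quasiSplit (↥(maximalRealSubfield L)) L (IsCMField.complexConj L) 2).Adelic) * ((q.out : (quasiSplit (↥(maximalRealSubfield L)) L (IsCMField.complexConj L) 2).quotientSubgroup) : (quasiSplit (↥(maximalRealSubfield L)) L (IsCMField.complexConj L) 2).Adelic))) 2 μ),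
          f = hθ.toLp _}).topologicalClosure := by
  obtain ⟨𝔓₀, hne₀, h𝔓₀, hE₀⟩ := exists_parabolicData_orthogonal_eq_of_eq' L (antidiagOne_eq_over (L := L) (N := 2))
  haveI := hne; haveI := hne₀
  have hrad : ∀ (i : 𝔓.ι) (j : 𝔓₀.ι), 𝔓.radical i = 𝔓₀.radical j := fun i j => by
    rw [h𝔓 i, h𝔓₀ j, comap_standardUnipotentRadical_eq_adelicUnipotent]
  rw [toSubmodule_cuspidalSubspace_eq_of_forall_radical_eq μ 𝔓 𝔓₀ hrad, setOf_pseudoEisenstein_eq_of_forall_radical_eq μ 𝔓 𝔓₀ hrad]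
  exact hE₀ inferInstance μ inferInstance

end Summit.HodgeConjecture.HodgeConjecture.Cruxes.H413.K2E1CuspidalDensityQuasiSplitBridgeCMTwo

end
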